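import Mathlib
import Summits.Ventures.HodgeRepro.Tier4.Common.AdelicDefs
import Summits.Ventures.HodgeRepro.Tier4.Line1.PlaneDefs

/-!
# Tier4/Line1/C7Components — the place components of `GA W` and the local unitary groups (C7.3d of the C7 census)

Blind re-derivation cell `pub-hodge-repro`, Tier 4, LINE L1, rung C7 (the fibration over the stabiliser,
I1c-rungs-sig.lean L85–L93; typed census `proofs/t4/L1/C7-rungs-sig.lean`, t4-L1-p4 with t4-L1-p2, lead g385 R-II
S12860).  Mathlib's adele ring IS `𝔸_{k,∞} × 𝔸_{k,f}` with `𝔸_{k,f} = Πʳ v, [k_v, 𝓞_v]`: the place decomposition of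
the RING is definitional, and this module records the GROUP-level vocabulary every other C7 rung uses — the
components `g_v ∈ M₄(k_v)` of an adelic matrix (`finMat`, `infMat`), of an adelic row vector (`finVec`, `infVec`),
the local unitary groups `U(W)(k_v)`, `U(W)(k_w)`, `U(W)(𝓞_v)` as sets of matrices (`localU`, `localUInf`,
`localUInt`: the two equations of `unitaryGroup W` read in `k_v`), the rational vector read locally (`finRat`,
`infRat`), the adelic box (`adelicBox`), and the S-sized facts: components are multiplicative, commute with `ᵥ*`
and with transposition, the rational vector has rational components, the components of an element of `GA W` are
local unitary, and adelic vectors / matrices are determined by their components.  No theorem here is about the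
intended objects beyond these identities.  HC_CM is NOT proved by anyone in this repository.
-/

set_option autoImplicit false
noncomputable section
namespace Summit.Ventures.HodgeRepro.Tier4.Line1
open NumberField IsDedekindDomain HeightOneSpectrum Topology Common Matrix

section C7Defs

variable {k : Type} [Field k] [NumberField k] (W : PlaneData k)

/-- (L0) evaluation of an adele at the finite place `v`, as a ring homomorphism. -/
def finHom (v : HeightOneSpectrum (𝓞 k)) : Ad k →+* v.adicCompletion k where
  toFun a := a.2 v
  map_one' := rfl
  map_mul' _ _ := rfl
  map_zero' := rfl
  map_add' _ _ := rfl

/-- (L0) evaluation of an adele at the infinite place `w`, as a ring homomorphism. -/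
def infHom (w : InfinitePlace k) : Ad k →+* w.Completion where
  toFun a := a.1 w
  map_one' := rfl
  map_mul' _ _ := rfl
  map_zero' := rfl
  map_add' _ _ := rfl

/-- `finHom` evaluates. -/
theorem finHom_apply (v : HeightOneSpectrum (𝓞 k)) (a : Ad k) : finHom (k := k) v a = a.2 v := rfl

/-- `infHom` evaluates. -/
theorem infHom_apply (w : InfinitePlace k) (a : Ad k) : infHom (k := k) w a = a.1 w := rfl

/-- (L0) the component at the finite place `v` of an adelic matrix, entrywise. -/
def finMat (v : HeightOneSpectrum (𝓞 k)) (g : M4 k) : Matrix (Fin 4) (Fin 4) (v.adicCompletion k) :=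
  g.map (fun a => a.2 v)

/-- (L0) the component at the infinite place `w` of an adelic matrix, entrywise. -/
def infMat (w : InfinitePlace k) (g : M4 k) : Matrix (Fin 4) (Fin 4) w.Completion :=
  g.map (fun a => a.1 w)

/-- (L0) the component at the finite place `v` of an adelic row vector. -/
def finVec (v : HeightOneSpectrum (𝓞 k)) (x : Fin 4 → Ad k) : Fin 4 → v.adicCompletion k :=
  fun i => (x i).2 v

/-- (L0) the component at the infinite place `w` of an adelic row vector. -/
def infVec (w : InfinitePlace k) (x : Fin 4 → Ad k) : Fin 4 → w.Completion :=
  fun i => (x i).1 w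

/-- (L1) THE LOCAL UNITARY GROUP `U(W)(k_v)` at a finite place, as a set of matrices: the two defining equations of
`unitaryGroup W` (`g Ω = Ω g`, `g B gᵀ = B`) read in `k_v`. -/
def localU (v : HeightOneSpectrum (𝓞 k)) : Set (Matrix (Fin 4) (Fin 4) (v.adicCompletion k)) :=
  {h | h * W.Ω.map (algebraMap k (v.adicCompletion k)) = W.Ω.map (algebraMap k (v.adicCompletion k)) * h ∧
    h * W.B.map (algebraMap k (v.adicCompletion k)) * hᵀ = W.B.map (algebraMap k (v.adicCompletion k))}

/-- (L1) THE LOCAL UNITARY GROUP `U(W)(k_w)` at an infinite place. -/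
def localUInf (w : InfinitePlace k) : Set (Matrix (Fin 4) (Fin 4) w.Completion) :=
  {h | h * W.Ω.map (algebraMap k w.Completion) = W.Ω.map (algebraMap k w.Completion) * h ∧
    h * W.B.map (algebraMap k w.Completion) * hᵀ = W.B.map (algebraMap k w.Completion)}

/-- (L2) THE INTEGRAL LOCAL UNITARY GROUP `U(W)(𝓞_v)`: local unitary with entries in `𝓞_v`. -/
def localUInt (v : HeightOneSpectrum (𝓞 k)) : Set (Matrix (Fin 4) (Fin 4) (v.adicCompletion k)) :=
  {h | h ∈ localU W v ∧ ∀ i j, h i j ∈ v.adicCompletionIntegers k}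

/-- (L3) the rational row vector `v₀` read in `k_v`. -/
def finRat (v : HeightOneSpectrum (𝓞 k)) (v₀ : Fin 4 → k) : Fin 4 → v.adicCompletion k :=
  fun i => algebraMap k (v.adicCompletion k) (v₀ i)

/-- (L3) the rational row vector `v₀` read in `k_w`. -/
def infRat (w : InfinitePlace k) (v₀ : Fin 4 → k) : Fin 4 → w.Completion :=
  fun i => algebraMap k w.Completion (v₀ i)

/-- (L4) THE ADELIC BOX in `GA W`: components in `Ki w` at every infinite place, in `Kf v` at the finite places of
`S`, integral (`U(W)(𝓞_v)`) at the finite places outside `S`. -/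
def adelicBox (S : Finset (HeightOneSpectrum (𝓞 k)))
    (Kf : ∀ v : HeightOneSpectrum (𝓞 k), Set (Matrix (Fin 4) (Fin 4) (v.adicCompletion k)))
    (Ki : ∀ w : InfinitePlace k, Set (Matrix (Fin 4) (Fin 4) w.Completion)) : Set (GA W) :=
  {g | (∀ w, infMat w (GA.mat W g) ∈ Ki w) ∧ (∀ v ∈ S, finMat v (GA.mat W g) ∈ Kf v) ∧
    ∀ v ∉ S, finMat v (GA.mat W g) ∈ localUInt W v}

end C7Defs

section C7Components

variable {k : Type} [Field k] [NumberField k] (W : PlaneData k)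

/-- `finMat` is the entrywise image under the ring homomorphism `finHom`. -/
theorem finMat_eq_map (v : HeightOneSpectrum (𝓞 k)) (g : M4 k) : finMat v g = g.map (finHom v) := rfl

/-- `infMat` is the entrywise image under the ring homomorphism `infHom`. -/
theorem infMat_eq_map (w : InfinitePlace k) (g : M4 k) : infMat w g = g.map (infHom w) := rfl

/-- (C7.3d) COMPONENTS ARE MULTIPLICATIVE at a finite place. -/
theorem finMat_mul (v : HeightOneSpectrum (𝓞 k)) (A B : M4 k) :
    finMat v (A * B) = finMat v A * finMat v B := by
  simp only [finMat_eq_map]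
  exact Matrix.map_mul

/-- (C7.3d) COMPONENTS ARE MULTIPLICATIVE at an infinite place. -/
theorem infMat_mul (w : InfinitePlace k) (A B : M4 k) :
    infMat w (A * B) = infMat w A * infMat w B := by
  simp only [infMat_eq_map]
  exact Matrix.map_mul

/-- (C7.3d) the component of the identity. -/
theorem finMat_one (v : HeightOneSpectrum (𝓞 k)) : finMat v (1 : M4 k) = 1 := by
  rw [finMat_eq_map]
  exact Matrix.map_one _ (map_zero _) (map_one _)

/-- (C7.3d) the component of the identity, infinite place. -/
theorem infMat_one (w : InfinitePlace k) : infMat w (1 : M4 k) = 1 := by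
  rw [infMat_eq_map]
  exact Matrix.map_one _ (map_zero _) (map_one _)

/-- (C7.3d) components commute with transposition. -/
theorem finMat_transpose (v : HeightOneSpectrum (𝓞 k)) (A : M4 k) : finMat v Aᵀ = (finMat v A)ᵀ := by
  simp only [finMat_eq_map]
  exact Matrix.transpose_map

/-- (C7.3d) components commute with transposition, infinite place. -/
theorem infMat_transpose (w : InfinitePlace k) (A : M4 k) : infMat w Aᵀ = (infMat w A)ᵀ := by
  simp only [infMat_eq_map]
  exact Matrix.transpose_map

/-- (C7.3d) the component of a rational matrix is the rational matrix read in `k_v`. -/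
theorem finMat_adMat (v : HeightOneSpectrum (𝓞 k)) (A : Matrix (Fin 4) (Fin 4) k) :
    finMat v (adMat k A) = A.map (algebraMap k (v.adicCompletion k)) := by
  rw [finMat_eq_map, adMat, Matrix.map_map]
  congr 1

/-- (C7.3d) the component of a rational matrix is the rational matrix read in `k_w`. -/
theorem infMat_adMat (w : InfinitePlace k) (A : Matrix (Fin 4) (Fin 4) k) :
    infMat w (adMat k A) = A.map (algebraMap k w.Completion) := by
  rw [infMat_eq_map, adMat, Matrix.map_map]
  rfl

/-- (C7.3d) `x A` read at `v` is `x` read at `v` times the component of `A`. -/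
theorem finVec_vecMul (v : HeightOneSpectrum (𝓞 k)) (x : Fin 4 → Ad k) (A : M4 k) :
    finVec v (x ᵥ* A) = finVec v x ᵥ* finMat v A := by
  funext i
  exact RingHom.map_vecMul (finHom v) A x i

/-- (C7.3d) `x A` read at `w` is `x` read at `w` times the component of `A`. -/
theorem infVec_vecMul (w : InfinitePlace k) (x : Fin 4 → Ad k) (A : M4 k) :
    infVec w (x ᵥ* A) = infVec w x ᵥ* infMat w A := by
  funext i
  exact RingHom.map_vecMul (infHom w) A x i

/-- (C7.3d) the rational vector has rational components at a finite place. -/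
theorem finVec_algebraMap (v : HeightOneSpectrum (𝓞 k)) (v₀ : Fin 4 → k) :
    finVec v (fun i => algebraMap k (Ad k) (v₀ i)) = finRat v v₀ := by
  funext i
  show (algebraMap k (Ad k) (v₀ i)).2 v = algebraMap k (v.adicCompletion k) (v₀ i)
  rw [AdeleRing.algebraMap_snd_apply, algebraMap_adicCompletion]
  rfl

/-- (C7.3d) the rational vector has rational components at an infinite place. -/
theorem infVec_algebraMap (w : InfinitePlace k) (v₀ : Fin 4 → k) :
    infVec w (fun i => algebraMap k (Ad k) (v₀ i)) = infRat w v₀ := rfl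

/-- (C7.3d) the components of an element of `GA W` are local unitary. -/
theorem finMat_mem_localU (g : GA W) (v : HeightOneSpectrum (𝓞 k)) :
    finMat v (GA.mat W g) ∈ localU W v := by
  obtain ⟨h1, h2⟩ := (mem_unitaryGroup W (g : GL4 k)).1 g.2
  refine ⟨?_, ?_⟩
  · have := congrArg (finMat v) h1
    rwa [finMat_mul, finMat_mul, finMat_adMat] at this
  · have := congrArg (finMat v) h2
    rwa [finMat_mul, finMat_mul, finMat_adMat, finMat_transpose] at this

/-- (C7.3d) the components of an element of `GA W` are local unitary, infinite place. -/
theorem infMat_mem_localUInf (g : GA W) (w : InfinitePlace k) :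
    infMat w (GA.mat W g) ∈ localUInf W w := by
  obtain ⟨h1, h2⟩ := (mem_unitaryGroup W (g : GL4 k)).1 g.2
  refine ⟨?_, ?_⟩
  · have := congrArg (infMat w) h1
    rwa [infMat_mul, infMat_mul, infMat_adMat] at this
  · have := congrArg (infMat w) h2
    rwa [infMat_mul, infMat_mul, infMat_adMat, infMat_transpose] at this

/-- (C7.3d) an adele is determined by its components. -/
theorem adele_ext_of_components {a b : Ad k} (hf : ∀ v : HeightOneSpectrum (𝓞 k), a.2 v = b.2 v)
    (hi : ∀ w : InfinitePlace k, a.1 w = b.1 w) : a = b := by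
  refine Prod.ext ?_ (FiniteAdeleRing.ext k hf)
  funext w
  exact hi w

/-- (C7.3d) two adelic vectors with the same components everywhere are equal. -/
theorem vec_ext_of_components {x y : Fin 4 → Ad k} (hf : ∀ v, finVec v x = finVec v y)
    (hi : ∀ w, infVec w x = infVec w y) : x = y := by
  funext i
  exact adele_ext_of_components (fun v => congrFun (hf v) i) (fun w => congrFun (hi w) i)

/-- (C7.3d) two adelic matrices with the same components everywhere are equal. -/
theorem mat_ext_of_components {A B : M4 k} (hf : ∀ v, finMat v A = finMat v B)
    (hi : ∀ w, infMat w A = infMat w B) : A = B := by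
  ext i j
  exact adele_ext_of_components (fun v => congrFun (congrFun (hf v) i) j)
    (fun w => congrFun (congrFun (hi w) i) j)

/-- (C7.3d) the component of a product in `GA W`. -/
theorem finMat_GA_mul (g h : GA W) (v : HeightOneSpectrum (𝓞 k)) :
    finMat v (GA.mat W (g * h)) = finMat v (GA.mat W g) * finMat v (GA.mat W h) := by
  rw [GA.mat_mul, finMat_mul]

/-- (C7.3d) the component of a product in `GA W`, infinite place. -/
theorem infMat_GA_mul (g h : GA W) (w : InfinitePlace k) :
    infMat w (GA.mat W (g * h)) = infMat w (GA.mat W g) * infMat w (GA.mat W h) := by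
  rw [GA.mat_mul, infMat_mul]

/-- (C7.3d) the component of an inverse in `GA W` is the inverse of the component. -/
theorem finMat_GA_inv (g : GA W) (v : HeightOneSpectrum (𝓞 k)) :
    finMat v (GA.mat W g⁻¹) = (finMat v (GA.mat W g))⁻¹ := by
  have h1 : finMat v (GA.mat W g⁻¹) * finMat v (GA.mat W g) = 1 := by
    rw [← finMat_mul, GA.mat_inv_mul, finMat_one]
  exact (Matrix.inv_eq_left_inv h1).symm

/-- (C7.3d) the component of an inverse in `GA W` is the inverse of the component, infinite place. -/
theorem infMat_GA_inv (g : GA W) (w : InfinitePlace k) :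
    infMat w (GA.mat W g⁻¹) = (infMat w (GA.mat W g))⁻¹ := by
  have h1 : infMat w (GA.mat W g⁻¹) * infMat w (GA.mat W g) = 1 := by
    rw [← infMat_mul, GA.mat_inv_mul, infMat_one]
  exact (Matrix.inv_eq_left_inv h1).symm

end C7Components

end Summit.Ventures.HodgeRepro.Tier4.Line1
end
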